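/-
Copyright (c) 2026. All rights reserved.
Released under Apache 2.0 license as described in the file LICENSE.
-/
import Summits.HodgeConjecture.HodgeConjecture.Theorems.K2LiuLocalSWBigCellContraction   -- ★ F3c-B3 `continuous_nElem` (+ ★ `K2LiuUnipDeltaLocalCoordinates`, ★ `continuous_blkB_matA`)
import Mathlib.Topology.Algebra.OpenSubgroup
import HarnessLib

/-!
# Crux `HLiu418`, #42S organ S1, ROAD W, file F3e: THE COORDINATE LATTICES `N_Λ = {u ∈ N_Δ : B(u) ∈ Λ}` (the `N₀, N₁, Fintype` binders of ★ `spanning_criterion`)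

Cell `hodgecm-mathlib`, crux item hLiu418 = `stmt-HodgeConjecture-24832`; squad K2 ∕ K2Liu; prover K2Liu-p06 (g4), the dedicated S1 hand.
THEOREMS ONLY (no `def`, no instance, no notation, no named-fact hypothesis, no `sorry`); lane `--supports stmt-HodgeConjecture-24832 --as helper`.

The witness binders of ★ F3d `localDegPS_le_of_witness` are phrased with two subgroups `N₀, N₁ ≤ H_v`, `N₁ = {u ∈ N_Δ : B(u) ∈ Λ}` for a compact open box `Λ`, and
`[Fintype (N₁ ⧸ N₀.subgroupOf N₁)]`.  This file supplies them BY VALUE from additive data on the coordinate space `M_n(E ⊗ F_v)` of `N_Δ ≅ {T₀-skew matrices}`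
(`u = n(B(u))`, `n(t) n(t′) = n(t + t′)`, ★ `K2LiuUnipDeltaLocalCoordinates`):
* §1 `blkB_matA_mul_of_mem`, `blkB_matA_inv_of_mem` (the coordinate `B` is a homomorphism `N_Δ → (M_n, +)`); **`exists_coordinateSubgroup`**: for every additive
  subgroup `Λ ≤ M_n(E ⊗ F_v)` there is a subgroup `N_Λ ≤ H_v` with `u ∈ N_Λ ↔ u ∈ N_Δ ∧ B(u) ∈ Λ`.
* §2 `isCompact_coordinateSubgroup` (`Λ` compact ⇒ `N_Λ` compact, via ★ `continuous_nElem`), `isOpen_subgroupOf_coordinateSubgroup` (`Λ₀` open ⇒ `N_{Λ₀} ∩ N_Λ` open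
  in `N_Λ`), **`finite_quotient_coordinateSubgroups`** (`Λ` compact, `Λ₀` open ⇒ `N_Λ ⧸ (N_{Λ₀} ∩ N_Λ)` finite — Mathlib's `Subgroup.quotient_finite_of_isOpen`).
The witness hands (F6 ∕ F7 ∕ F8) pick `Λ₀ ≤ Λ` (e.g. `ϖ^{k} M_n(𝒪) ≤ ϖ^{-m} M_n(𝒪)`, ★ `intMatrices`) and read `N₀, N₁, Fintype.ofFinite` off this file.
References: [BernsteinZelevinsky1976] §1.5; [Kudla1994] §3; [HarrisKudlaSweet1996] §1 (1.11)–(1.12).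
HONEST LABEL.  Count-neutral helper: `HC_CM` is proved only modulo the 7 printed citations (2 remaining named inputs: hLiu418 = `stmt-HodgeConjecture-24832`,
h413 = `stmt-HodgeConjecture-24833`) until rung 0 closes.
-/

set_option autoImplicit false
set_option linter.dupNamespace false -- the mandated namespace repeats `HodgeConjecture.HodgeConjecture`

noncomputable section

open NumberField IsDedekindDomain Matrix
open Literature.NumberTheory.Automorphic Literature.NumberTheory.Automorphic.UnitaryGroup
open Literature.NumberTheory.GelbartRogawski1991.AdaptedBlocks
open Literature.NumberTheory.GelbartRogawski1991.UnitaryDualPair.LocalSplitting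
open Literature.NumberTheory.K2Lit.LocalSiegelDoubled
open Summit.HodgeConjecture.HodgeConjecture.Cruxes.HLiu418.K2LiuLocalSWBigCellContraction
open Summit.HodgeConjecture.HodgeConjecture.Cruxes.HLiu418.K2LiuUnipDeltaLocalCoordinates
open Summit.HodgeConjecture.HodgeConjecture.Cruxes.HLiu418.K2LiuUnipDeltaRankOneHaar

namespace Summit.HodgeConjecture.HodgeConjecture.Cruxes.HLiu418.K2LiuLocalSWCoordinateLattices

variable (F : Type) [Field F] [NumberField F] (E : Type) [Field E] [NumberField E] [Algebra F E]
  (c : E ≃ₐ[F] E) (v : HeightOneSpectrum (𝓞 F)) (n : ℕ) {T₀ : Matrix (Fin n) (Fin n) F}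
  {JD : Matrix (Fin (n + n)) (Fin (n + n)) E} (hJD : JD = (gramD F n T₀).map (algebraMap F E))

/-! ## §1 `B : N_Δ → (M_n, +)` is a homomorphism; the coordinate subgroups -/

include hJD in
/-- `B(u u′) = B(u) + B(u′)` on `N_Δ(F_v)` (`n(t) n(t′) = n(t + t′)`, ★ `nElem_add`). [cite: HarrisKudlaSweet1996, §1 (1.12)] -/
theorem blkB_matA_mul_of_mem {u u' : UnitaryGroup.localPi E c (n + n) JD v}
    (hu : u ∈ unipDeltaLocal F E c v n (JD := JD)) (hu' : u' ∈ unipDeltaLocal F E c v n (JD := JD)) :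
    blkB (matA F E c v n (u * u')) = blkB (matA F E c v n u) + blkB (matA F E c v n u') := by
  have h : u * u' = nElem F E c v n hJD _ (skew_add F E c v n (skew_blkB_of_mem_unipDeltaLocal F E c v n hJD hu)
      (skew_blkB_of_mem_unipDeltaLocal F E c v n hJD hu')) := by
    rw [nElem_add F E c v n hJD (skew_blkB_of_mem_unipDeltaLocal F E c v n hJD hu) (skew_blkB_of_mem_unipDeltaLocal F E c v n hJD hu'),
      ← eq_nElem_of_mem_unipDeltaLocal F E c v n hJD hu, ← eq_nElem_of_mem_unipDeltaLocal F E c v n hJD hu']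
  rw [h, blkB_matA_nElem]

include hJD in
/-- `B(u⁻¹) = −B(u)` on `N_Δ(F_v)` (`n(t)⁻¹ = n(−t)`, ★ `nElem_inv`). [cite: HarrisKudlaSweet1996, §1 (1.12)] -/
theorem blkB_matA_inv_of_mem {u : UnitaryGroup.localPi E c (n + n) JD v} (hu : u ∈ unipDeltaLocal F E c v n (JD := JD)) :
    blkB (matA F E c v n u⁻¹) = -blkB (matA F E c v n u) := by
  have h : u⁻¹ = nElem F E c v n hJD _ (skew_neg F E c v n (skew_blkB_of_mem_unipDeltaLocal F E c v n hJD hu)) := by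
    rw [← nElem_inv F E c v n hJD _ (skew_blkB_of_mem_unipDeltaLocal F E c v n hJD hu), ← eq_nElem_of_mem_unipDeltaLocal F E c v n hJD hu]
  rw [h, blkB_matA_nElem]

include hJD in
/-- **THE COORDINATE SUBGROUP `N_Λ`.**  For every additive subgroup `Λ ≤ M_n(E ⊗ F_v)` there is a subgroup `N_Λ ≤ H_v` with `u ∈ N_Λ ↔ u ∈ N_Δ ∧ B(u) ∈ Λ` (the shape of
the `hN₁` binder of ★ `exists_contracting` ∕ ★ `localDegPS_le_of_witness`). [cite: HarrisKudlaSweet1996, §1 (1.12)] [cite: BernsteinZelevinsky1976, §1.5] -/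
theorem exists_coordinateSubgroup (Λ : AddSubgroup (Matrix (Fin n) (Fin n) (LocalRing E v))) :
    ∃ NΛ : Subgroup (UnitaryGroup.localPi E c (n + n) JD v),
      ∀ u, u ∈ NΛ ↔ u ∈ unipDeltaLocal F E c v n (JD := JD) ∧ blkB (matA F E c v n u) ∈ Λ := by
  refine ⟨{ carrier := {u | u ∈ unipDeltaLocal F E c v n (JD := JD) ∧ blkB (matA F E c v n u) ∈ Λ}
            mul_mem' := fun {u u'} hu hu' => ⟨Subgroup.mul_mem _ hu.1 hu'.1, ?_⟩
            one_mem' := ⟨Subgroup.one_mem _, by rw [matA_one, blkB_one]; exact Λ.zero_mem⟩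
            inv_mem' := fun {u} hu => ⟨Subgroup.inv_mem _ hu.1, ?_⟩ }, fun u => Iff.rfl⟩
  · rw [blkB_matA_mul_of_mem F E c v n hJD hu.1 hu'.1]
    exact Λ.add_mem hu.2 hu'.2
  · rw [blkB_matA_inv_of_mem F E c v n hJD hu.1]
    exact Λ.neg_mem hu.2

/-! ## §2 Compactness, openness, finiteness -/

include hJD in
/-- **`N_Λ` is compact when `Λ` is**: `N_Λ = n(Λ ∩ skew)`, the image of a compact set under the continuous ★ `continuous_nElem`. [cite: BernsteinZelevinsky1976, §1.5] -/
theorem isCompact_coordinateSubgroup {Λ : Set (Matrix (Fin n) (Fin n) (LocalRing E v))} (hΛc : IsCompact Λ)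
    {NΛ : Subgroup (UnitaryGroup.localPi E c (n + n) JD v)} (hN : ∀ u, u ∈ NΛ ↔ u ∈ unipDeltaLocal F E c v n (JD := JD) ∧ blkB (matA F E c v n u) ∈ Λ) :
    IsCompact (NΛ : Set (UnitaryGroup.localPi E c (n + n) JD v)) := by
  have h𝔰c : IsClosed {t : Matrix (Fin n) (Fin n) (LocalRing E v) | (t.map (conjLocal E c v))ᵀ * gramS F E v n T₀ + gramS F E v n T₀ * t = 0} :=
    isClosed_eq (((continuous_id.matrix_map (continuous_conjLocal E c v)).matrix_transpose.mul continuous_const).add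
      (continuous_const.mul continuous_id)) continuous_const
  have hKc : IsCompact (Subtype.val ⁻¹' Λ : Set {t : Matrix (Fin n) (Fin n) (LocalRing E v) //
      (t.map (conjLocal E c v))ᵀ * gramS F E v n T₀ + gramS F E v n T₀ * t = 0}) :=
    h𝔰c.isClosedEmbedding_subtypeVal.isCompact_preimage hΛc
  have himage : (NΛ : Set (UnitaryGroup.localPi E c (n + n) JD v)) =
      (fun t : {t : Matrix (Fin n) (Fin n) (LocalRing E v) // (t.map (conjLocal E c v))ᵀ * gramS F E v n T₀ + gramS F E v n T₀ * t = 0} =>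
        nElem F E c v n hJD t.1 t.2) '' (Subtype.val ⁻¹' Λ) := by
    ext u
    constructor
    · intro hu
      obtain ⟨huN, huΛ⟩ := (hN u).1 hu
      exact ⟨⟨blkB (matA F E c v n u), skew_blkB_of_mem_unipDeltaLocal F E c v n hJD huN⟩, huΛ,
        (eq_nElem_of_mem_unipDeltaLocal F E c v n hJD huN).symm⟩
    · rintro ⟨t, ht, rfl⟩
      exact (hN _).2 ⟨nElem_mem_unipDeltaLocal F E c v n hJD t.1 t.2, by rw [blkB_matA_nElem]; exact ht⟩
  rw [himage]
  exact hKc.image (continuous_nElem F E c v n hJD)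

/-- **`N_{Λ₀} ∩ N_Λ` is open in `N_Λ` when `Λ₀` is open** (preimage of `Λ₀` under the continuous coordinate `B`). [cite: BernsteinZelevinsky1976, §1.5] -/
theorem isOpen_subgroupOf_coordinateSubgroup {Λ₀ : Set (Matrix (Fin n) (Fin n) (LocalRing E v))} (hΛ₀o : IsOpen Λ₀)
    {N₀ NΛ : Subgroup (UnitaryGroup.localPi E c (n + n) JD v)}
    (hN₀ : ∀ u, u ∈ N₀ ↔ u ∈ unipDeltaLocal F E c v n (JD := JD) ∧ blkB (matA F E c v n u) ∈ Λ₀) (hNΛ : NΛ ≤ unipDeltaLocal F E c v n (JD := JD)) :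
    IsOpen ((N₀.subgroupOf NΛ : Subgroup NΛ) : Set NΛ) := by
  have h : ((N₀.subgroupOf NΛ : Subgroup NΛ) : Set NΛ) = (fun x : NΛ => blkB (matA F E c v n (x : UnitaryGroup.localPi E c (n + n) JD v))) ⁻¹' Λ₀ := by
    ext x
    rw [SetLike.mem_coe, Subgroup.mem_subgroupOf, hN₀, Set.mem_preimage]
    exact ⟨fun hx => hx.2, fun hx => ⟨hNΛ x.2, hx⟩⟩
  rw [h]
  exact hΛ₀o.preimage ((continuous_blkB_matA F E c v n (JD := JD)).comp continuous_subtype_val)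

include hJD in
/-- **`N_Λ ⧸ (N_{Λ₀} ∩ N_Λ)` IS FINITE** for `Λ` compact and `Λ₀` open (a compact group modulo an open subgroup) — the `[Fintype (N₁ ⧸ N₀.subgroupOf N₁)]` binder of
★ `spanning_criterion` ∕ ★ `localDegPS_le_of_witness` by value (`Fintype.ofFinite`). [cite: BernsteinZelevinsky1976, §1.5] -/
theorem finite_quotient_coordinateSubgroups {Λ₀ Λ : Set (Matrix (Fin n) (Fin n) (LocalRing E v))} (hΛc : IsCompact Λ) (hΛ₀o : IsOpen Λ₀)
    {N₀ NΛ : Subgroup (UnitaryGroup.localPi E c (n + n) JD v)}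
    (hN₀ : ∀ u, u ∈ N₀ ↔ u ∈ unipDeltaLocal F E c v n (JD := JD) ∧ blkB (matA F E c v n u) ∈ Λ₀)
    (hN : ∀ u, u ∈ NΛ ↔ u ∈ unipDeltaLocal F E c v n (JD := JD) ∧ blkB (matA F E c v n u) ∈ Λ) :
    Finite (NΛ ⧸ N₀.subgroupOf NΛ) := by
  haveI : CompactSpace NΛ := isCompact_iff_compactSpace.1 (isCompact_coordinateSubgroup F E c v n hJD hΛc hN)
  exact Subgroup.quotient_finite_of_isOpen _ (isOpen_subgroupOf_coordinateSubgroup F E c v n hΛ₀o hN₀ fun u hu => ((hN u).1 hu).1)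

end Summit.HodgeConjecture.HodgeConjecture.Cruxes.HLiu418.K2LiuLocalSWCoordinateLattices

end
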